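import Summits.NavierStokesRegularity.NavierStokesRegularity.Theses.TautLoopKelvin
import HarnessLib

/-!
# Birth skeleton (BC3) — crux `TautLoopLaw` (stmt-NavierStokesRegularity-15249) of route
# `TautLoopKelvin` (route-NavierStokesRegularity-TautLoopKelvin)

THEOREM L (integrated robust form): for a classical Leray–Hopf solution from a rapidly decaying datum
on `[0,T)`, a level `g > 0`, times `0 ≤ t₁ ≤ t₂ < T` and a measurable majorant `Φ` of the near-taut
compression rate `Λ_g` on `(t₁,t₂)` with `∫ Φ⁺ ≤ M`: `ℓ(g,t₁) · e^{-M} ≤ ℓ(g,t₂)` in `[0,∞]`, where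
`ℓ(g,t) = inf {length C : C a closed C¹ loop, |∮_C u(t)·dl| ≥ g}` (the circulation–length spectrum,
`inf ∅ = ⊤`).

LINE (three registered stubs, composition kernel-checked, sorries ONLY in `stub_*`):

* `stub_restPropagation` — the `⊤`-EDGE: an irrotational slice stays irrotational (all loop
  circulations zero at `t₁` ⇒ at `t₂`); mechanism = Liouville + energy/uniqueness, not Grönwall.
* `stub_finiteRelaxedLaw` — the FINITE, LEVEL-RELAXED law: both admissible classes nonempty,
  conclusion `ℓ(g',t₁) e^{-M} ≤ ℓ(g,t₂)` for every `0 < g' < g` (pull-back Grönwall along the flow with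
  the `o(h)` level loss of Kelvin-with-viscosity at taut loops left in). HARDEST stub.
* `stub_levelLeftContinuity` — LEVEL LEFT-CONTINUITY `ℓ(g,t) ≤ sup_{g'<g} ℓ(g',t)` at a nonempty level
  (compactness of near-minimisers + lasso surgery): exactly the "persistent level jump", the one
  structural failure mode of the integrated form flagged by the route review, isolated as a lemma.
* `TautLoopLaw_of : TautLoopLaw` — the crux BY NAME (A12 shape: no hypotheses, the stubs are invoked
  inside; the arrow form `stub₁ → stub₂ → stub₃ → TautLoopLaw` is the body). Real proof: case split on
  emptiness of the level-`g` class at `t₂` (empty ⇒ RHS `= ⊤`); else Stub 1 (contrapositive) gives a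
  loop with nonzero circulation at `t₁`, whose `k`-fold cover (proved here: `isC1Loop_comp_natMul`,
  `circulation_comp_natMul`, `exists_level_of_circulation_ne_zero`) is admissible at level `g`; then
  Stub 2 for every `g' < g`, Stub 3 at `t₁`, and `ENNReal.iSup_mul` close the chain.

Disproof used: none exists for this crux (no `Disproof.lean`, `ledger crux ls` empty 2026-08-17); negatives
index of the summit (3 items: AdiabaticEddy corrector, SymmetryModuliCount, Blowup X5b) untouched — no
stub is an instance of a refuted statement. Probes (BC3): for each stub, `stub → TautLoopLaw` and
`stub → NavierStokesRegularity` under `first | exact? | simpa | aesop` FAIL (NOTES.md probe record of the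
registering seat). Typing checklist 4c: (ii) every `∫` is over a `C¹` loop / continuous slice or is the
crux's own `∫⁻`; no hand-picked thresholds; statements are level/scale covariant like the crux.
-/

set_option linter.dupNamespace false
set_option linter.unusedVariables false

noncomputable section

open Literature.Analysis.FluidPDE MeasureTheory Set Function Filter
open scoped ENNReal NNReal Topology InnerProductSpace RealInnerProductSpace

namespace Summit.NavierStokesRegularity.NavierStokesRegularity.Cruxes.TautLoopLaw.Birth


/-! ## Helper lemmas (sorry-free): `k`-fold covers of loops multiply circulation by `k` -/

/-- The `k`-fold cover `s ↦ γ (k s)` of a closed `C¹` loop is a closed `C¹` loop. [folklore] -/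
theorem isC1Loop_comp_natMul {γ : ℝ → EuclideanSpace ℝ (Fin 3)} (hγ : IsC1Loop γ) (k : ℕ) :
    IsC1Loop (fun s => γ ((k : ℝ) * s)) := by
  refine ⟨hγ.contDiff.comp (contDiff_const.mul contDiff_id), fun s => ?_⟩
  show γ ((k : ℝ) * (s + 1)) = γ ((k : ℝ) * s)
  have h := hγ.periodic.nat_mul k ((k : ℝ) * s)
  rw [mul_one] at h
  rw [mul_add, mul_one]
  exact h

/-- The circulation around the `k`-fold cover is `k` times the circulation (continuous field).
[folklore] -/
theorem circulation_comp_natMul {v : EuclideanSpace ℝ (Fin 3) → EuclideanSpace ℝ (Fin 3)}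
    (hv : Continuous v) {γ : ℝ → EuclideanSpace ℝ (Fin 3)} (hγ : IsC1Loop γ) (k : ℕ) :
    circulation v (fun s => γ ((k : ℝ) * s)) = (k : ℝ) * circulation v γ := by
  -- the integrand of the circulation of `γ` and its periodicity / integrability
  set f : ℝ → ℝ := fun σ => ⟪v (γ σ), deriv γ σ⟫ with hf
  have hfper : Periodic f 1 := fun σ => by
    simp only [hf, hγ.periodic σ, hγ.periodic_deriv σ]
  have hfcont : Continuous f := (hv.comp hγ.continuous).inner hγ.continuous_deriv
  have hfint : ∀ a b : ℝ, IntervalIntegrable f volume a b := fun a b => hfcont.intervalIntegrable a b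
  -- the cover's integrand is `k • f (k σ)`
  have hderiv : ∀ s : ℝ, deriv (fun s => γ ((k : ℝ) * s)) s = (k : ℝ) • deriv γ ((k : ℝ) * s) := by
    intro s
    exact deriv_comp_mul_left (k : ℝ) γ s
  have hint : circulation v (fun s => γ ((k : ℝ) * s)) = ∫ s in (0:ℝ)..1, (k : ℝ) * f ((k : ℝ) * s) := by
    unfold circulation
    congr 1
    funext s
    rw [hderiv s, inner_smul_right]
  rw [hint, intervalIntegral.integral_const_mul]
  -- substitution `σ = k s` and periodicity: `k • ∫₀¹ f (k s) ds = ∫₀ᵏ f = k • ∫₀¹ f`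
  have hsub : (k : ℝ) • ∫ s in (0:ℝ)..1, f ((k : ℝ) * s) = ∫ σ in (0:ℝ)..(k : ℝ), f σ := by
    have h := intervalIntegral.smul_integral_comp_mul_left (a := (0:ℝ)) (b := 1) f (k : ℝ)
    rw [mul_zero, mul_one] at h
    exact h
  have hper : ∫ σ in (0:ℝ)..(k : ℝ), f σ = (k : ℝ) * ∫ σ in (0:ℝ)..1, f σ := by
    have h := hfper.intervalIntegral_add_zsmul_eq (k : ℤ) 0 hfint
    simp only [zero_add, zsmul_eq_mul, Int.cast_natCast, mul_one] at h
    simpa using h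
  have hcirc : circulation v γ = ∫ σ in (0:ℝ)..1, f σ := rfl
  rw [hcirc, ← hper, ← hsub, smul_eq_mul]

/-- A loop with nonzero circulation yields, by a `k`-fold cover, an admissible loop at any level
`g > 0`: the level-`g` admissible class is empty iff ALL loop circulations vanish. [folklore] -/
theorem exists_level_of_circulation_ne_zero {v : EuclideanSpace ℝ (Fin 3) → EuclideanSpace ℝ (Fin 3)}
    (hv : Continuous v) {γ : ℝ → EuclideanSpace ℝ (Fin 3)} (hγ : IsC1Loop γ)
    (hc : circulation v γ ≠ 0) {g : ℝ} (hg : 0 < g) :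
    ∃ γ' : ℝ → EuclideanSpace ℝ (Fin 3), IsC1Loop γ' ∧ g ≤ |circulation v γ'| := by
  have hcpos : 0 < |circulation v γ| := abs_pos.mpr hc
  obtain ⟨k, hk⟩ := exists_nat_ge (g / |circulation v γ|)
  refine ⟨fun s => γ ((k : ℝ) * s), isC1Loop_comp_natMul hγ k, ?_⟩
  rw [circulation_comp_natMul hv hγ k, abs_mul, Nat.abs_cast]
  rw [div_le_iff₀ hcpos] at hk
  exact hk

/-! ## The three registered stubs (signatures written out over existing declarations) -/

/-- **Stub 1 — REST PROPAGATION (the `⊤`-edge of the law; M–L).** For a classical Leray–Hopf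
solution from a rapidly decaying datum on `[0,T)` and `0 ≤ t₁ ≤ t₂ < T`: if every closed `C¹` loop has
zero circulation at time `t₁`, then every closed `C¹` loop has zero circulation at time `t₂`
("circulation is not created from an irrotational slice"). Intended proof: all circulations vanish ⇒
`curl u(t₁) = 0` (Stokes on discs, `circulation_circleLoop_eq_integral_curl`) ⇒ with `div u(t₁) = 0`
and `u(t₁) ∈ L²` (`IsLerayHopfOn.memLp`) Liouville gives `u(t₁) = 0` ⇒ energy equality / weak–strong
uniqueness in the classical Leray–Hopf class gives `u ≡ 0` on `[t₁,T)`. This is exactly the case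
`ℓ(g,t₁) = ⊤` of `TautLoopLaw` (`⊤ · e^{-M} = ⊤` forces `ℓ(g,t₂) = ⊤`), a different mechanism
(energy/uniqueness) from the pull-back Grönwall. [refuter rreview-0816T14 note on item 15249;
Galdi 2000 Thm 4.1; Serrin 1963 §3] -/
theorem stub_restPropagation :
    ∀ (ν T : ℝ), 0 < ν → 0 < T → ∀ (u : ℝ → EuclideanSpace ℝ (Fin 3) → EuclideanSpace ℝ (Fin 3)) (p : ℝ → EuclideanSpace ℝ (Fin 3) → ℝ), Literature.Analysis.FluidPDE.IsClassicalNSSolutionOn (Set.Ico 0 T) ν 0 u p → Literature.Analysis.FluidPDE.IsLerayHopfOn T ν 0 (u 0) u → Literature.Analysis.FluidPDE.HasRapidSpatialDecay (u 0) → ∀ t₁ t₂ : ℝ, 0 ≤ t₁ → t₁ ≤ t₂ → t₂ < T → (∀ γ : ℝ → EuclideanSpace ℝ (Fin 3), Literature.Analysis.FluidPDE.IsC1Loop γ → Literature.Analysis.FluidPDE.circulation (u t₁) γ = 0) → ∀ γ : ℝ → EuclideanSpace ℝ (Fin 3), Literature.Analysis.FluidPDE.IsC1Loop γ → Literature.Analysis.FluidPDE.circulation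 (u t₂) γ = 0 := by
  sorry

/-- **Stub 2 — FINITE LEVEL-RELAXED TAUT-LOOP LAW (the analytic heart; L, hardest).** Same
solutions, level `g > 0`, `0 ≤ t₁ ≤ t₂ < T`, a measurable majorant `Φ` of the near-taut compression
rate `Λ_g` on `(t₁,t₂)` with `∫ Φ⁺ ≤ M`; assume the level-`g` admissible class is NONEMPTY at `t₁`
and at `t₂` (the genuinely finite case: both spectra `< ⊤`). Then for every lower level `0 < g' < g`:
`ℓ(g',t₁) · e^{-M} ≤ ℓ(g,t₂)`. This is the pull-back Grönwall with the LEVEL LOSS left in: near-taut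
loops at time `s` pulled back along the flow to `s-h` lose level only `o(h)` (Kelvin with viscosity +
the draining sign `TautLoopStatic` at taut loops) and gain length at rate `Λ_g(s)`; summing over a
partition and letting the mesh → 0 leaves an arbitrarily small total level loss `g - g'`, but not zero.
Strictly weaker than the crux (monotonicity `ℓ(g') ≤ ℓ(g)`); the crux = this + Stub 3 + Stub 1.
[card taut-loop-kelvin-law K-law; doi:10.1002/cpa.20192 (Constantin–Iyer, Kelvin in expectation);
Majda–Bertozzi 2002 §1.6 (1.61); arXiv:0912.5226, arXiv:1305.1871 (closed magnetic geodesics: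
minimisers of length under a flux constraint)] -/
theorem stub_finiteRelaxedLaw :
    ∀ (ν T : ℝ), 0 < ν → 0 < T → ∀ (u : ℝ → EuclideanSpace ℝ (Fin 3) → EuclideanSpace ℝ (Fin 3)) (p : ℝ → EuclideanSpace ℝ (Fin 3) → ℝ), Literature.Analysis.FluidPDE.IsClassicalNSSolutionOn (Set.Ico 0 T) ν 0 u p → Literature.Analysis.FluidPDE.IsLerayHopfOn T ν 0 (u 0) u → Literature.Analysis.FluidPDE.HasRapidSpatialDecay (u 0) → ∀ g : ℝ, 0 < g → ∀ t₁ t₂ : ℝ, 0 ≤ t₁ → t₁ ≤ t₂ → t₂ < T → ∀ (Φ : ℝ → ℝ) (M : ℝ), Measurable Φ → 0 ≤ M → (∀ s ∈ Set.Ioo t₁ t₂, (⨅ ε : {ε : ℝ // 0 < ε}, sSup {k : ℝ | ∃ γ : ℝ → EuclideanSpace ℝ (Fin 3), Literature.Analysis.FluidPDE.IsC1Loop γ ∧ g ≤ |Literature.Analysis.FluidPDE.circulation (u s) γ| ∧ ENNReal.ofReal (∫ σ in (0:ℝ)..1, ‖deriv γ σ‖) ≤ (⨅ (γ' : ℝ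 → EuclideanSpace ℝ (Fin 3)) (_ : Literature.Analysis.FluidPDE.IsC1Loop γ' ∧ g ≤ |Literature.Analysis.FluidPDE.circulation (u s) γ'|), ENNReal.ofReal (∫ σ in (0:ℝ)..1, ‖deriv γ' σ‖)) + ENNReal.ofReal (ε : ℝ) ∧ k = ((∫ σ in (0:ℝ)..1, -(inner ℝ (deriv γ σ) (fderiv ℝ (u s) (γ σ) (deriv γ σ))) / ‖deriv γ σ‖) / (∫ σ in (0:ℝ)..1, ‖deriv γ σ‖))}) ≤ Φ s) → (∫⁻ s in Set.Ioo t₁ t₂, ENNReal.ofReal (Φ s)) ≤ ENNReal.ofReal M → (∃ γ : ℝ → EuclideanSpace ℝ (Fin 3), Literature.Analysis.FluidPDE.IsC1Loop γ ∧ g ≤ |Literature.Analysis.FluidPDE.circulation (u t₁) γ|) → (∃ γ : ℝ → EuclideanSpace ℝ (Fin 3), Literature.Analysis.FluidPDE.IsC1Loop γ ∧ g ≤ |Literature.Analysis.FluidPDE.circulation (u t₂) γ|) → ∀ g' : ℝ, 0 < g' → g' < g → (⨅ (γ' : ℝ → EuclideanSpace ℝ (Fin 3)) (_ : Literature.Analysis.FluidPDE.IsC1Loop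 γ' ∧ g' ≤ |Literature.Analysis.FluidPDE.circulation (u t₁) γ'|), ENNReal.ofReal (∫ σ in (0:ℝ)..1, ‖deriv γ' σ‖)) * ENNReal.ofReal (Real.exp (-M)) ≤ (⨅ (γ' : ℝ → EuclideanSpace ℝ (Fin 3)) (_ : Literature.Analysis.FluidPDE.IsC1Loop γ' ∧ g ≤ |Literature.Analysis.FluidPDE.circulation (u t₂) γ'|), ENNReal.ofReal (∫ σ in (0:ℝ)..1, ‖deriv γ' σ‖)) := by
  sorry

/-- **Stub 3 — LEVEL LEFT-CONTINUITY OF THE CIRCULATION–LENGTH SPECTRUM (the structural failure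
mode isolated; M–L).** For every slice `u(t)`, `t ∈ [0,T)`, of such a solution and every level `g > 0`
whose admissible class is nonempty: `ℓ(g,t) ≤ sup_{0<g'<g} ℓ(g',t)` (hence `=`, by monotonicity), i.e.
no persistent jump `ℓ(g⁻,t) < ℓ(g,t)`. Intended proof: near-optimal loops at levels `g' ↑ g` have
bounded length and are confined (far-field smallness of `u(t)`), so (Arzelà–Ascoli, constant-speed
parametrisation) converge to a Lipschitz loop `γ*` with `|Γ(γ*)| ≥ g`, `len ≤ ℓ(g⁻)`; periodic
mollification gives `C¹` loops with `len ≤ len γ*` and `Γ → Γ(γ*)`; the residual level deficit is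
repaired at vanishing length cost by a small lasso at a point near `γ*` where `ω ≠ 0` (if `ω ≡ 0` near
`γ*`, `Γ` is locally constant there and there is no deficit); cusps are admissible since `IsC1Loop`
does not require an immersion. Foreseen split: (3a) the statement for `C¹` fields tending to `0` at
infinity (pure geometry) + (3b) far-field decay of classical Leray–Hopf slices from rapidly decaying
data. [refuter rreview-0816T14: "a persistent jump ℓ(g−,t) < ℓ(g,t) is the only structural failure
mode of the integrated form"; arXiv:0912.5226 §2 (existence of flux-constrained length minimisers)] -/
theorem stub_levelLeftContinuity :
    ∀ (ν T : ℝ), 0 < ν → 0 < T → ∀ (u : ℝ → EuclideanSpace ℝ (Fin 3) → EuclideanSpace ℝ (Fin 3)) (p : ℝ → EuclideanSpace ℝ (Fin 3) → ℝ), Literature.Analysis.FluidPDE.IsClassicalNSSolutionOn (Set.Ico 0 T) ν 0 u p → Literature.Analysis.FluidPDE.IsLerayHopfOn T ν 0 (u 0) u → Literature.Analysis.FluidPDE.HasRapidSpatialDecay (u 0) → ∀ t ∈ Set.Ico 0 T, ∀ g : ℝ, 0 < g → (∃ γ : ℝ → EuclideanSpace ℝ (Fin 3), Literature.Analysis.FluidPDE.IsC1Loop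 γ ∧ g ≤ |Literature.Analysis.FluidPDE.circulation (u t) γ|) → (⨅ (γ' : ℝ → EuclideanSpace ℝ (Fin 3)) (_ : Literature.Analysis.FluidPDE.IsC1Loop γ' ∧ g ≤ |Literature.Analysis.FluidPDE.circulation (u t) γ'|), ENNReal.ofReal (∫ σ in (0:ℝ)..1, ‖deriv γ' σ‖)) ≤ ⨆ (g' : ℝ) (_ : 0 < g' ∧ g' < g), (⨅ (γ' : ℝ → EuclideanSpace ℝ (Fin 3)) (_ : Literature.Analysis.FluidPDE.IsC1Loop γ' ∧ g' ≤ |Literature.Analysis.FluidPDE.circulation (u t) γ'|), ENNReal.ofReal (∫ σ in (0:ℝ)..1, ‖deriv γ' σ‖)) := by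
  sorry


/-! ## The composition: the crux BY NAME from the three stubs (real proof) -/

/-- Notation (proof-side only; the registered stub signatures above are written out in full):
`ℓ⟦v, g⟧` = the circulation–length spectrum of the field `v` at level `g`, in `ℝ≥0∞`. -/
local notation3 "ℓ⟦" v ", " g "⟧" => (⨅ (γ' : ℝ → EuclideanSpace ℝ (Fin 3)) (_ : Literature.Analysis.FluidPDE.IsC1Loop γ' ∧ g ≤ |Literature.Analysis.FluidPDE.circulation v γ'|), ENNReal.ofReal (∫ σ in (0:ℝ)..1, ‖deriv γ' σ‖))

/-- **Skeleton theorem (A12 shape, kernel-checked): `TautLoopLaw` BY NAME from the three stubs.**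
Body = the arrow form `stub_restPropagation → stub_finiteRelaxedLaw → stub_levelLeftContinuity →
TautLoopLaw`; no hypotheses; the only sorries of the file live in the three `stub_*`. -/
theorem TautLoopLaw_of :
    Summit.NavierStokesRegularity.NavierStokesRegularity.Theses.TautLoopKelvin.TautLoopLaw := by
  intro ν T hν hT u p hcl hLH hdec g hg t₁ t₂ ht₁ ht₁₂ ht₂ Φ M hΦ hM hmaj hint
  -- Case A: the level-`g` admissible class at `t₂` is empty — the right-hand side is `⊤`.
  by_cases hB : ∃ γ : ℝ → EuclideanSpace ℝ (Fin 3), IsC1Loop γ ∧ g ≤ |circulation (u t₂) γ|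
  swap
  · exact le_iInf₂ fun γ hγ => absurd ⟨γ, hγ⟩ hB
  -- Case B: some loop carries level `g` at `t₂`.
  obtain ⟨γ₂, hγ₂, hg₂⟩ := hB
  have hc₂ : circulation (u t₂) γ₂ ≠ 0 := by
    intro h0
    rw [h0, abs_zero] at hg₂
    exact absurd hg₂ (not_le.mpr hg)
  -- Stub 1 (contrapositive): the slice at `t₁` is not irrotational.
  have hrot : ∃ γ₀ : ℝ → EuclideanSpace ℝ (Fin 3), IsC1Loop γ₀ ∧ circulation (u t₁) γ₀ ≠ 0 := by
    by_contra hall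
    refine hc₂ (stub_restPropagation ν T hν hT u p hcl hLH hdec t₁ t₂ ht₁ ht₁₂ ht₂ (fun γ hγ => ?_) γ₂ hγ₂)
    by_contra hne
    exact hall ⟨γ, hγ, hne⟩
  obtain ⟨γ₀, hγ₀, hc₀⟩ := hrot
  have ht₁T : t₁ ∈ Set.Ico 0 T := ⟨ht₁, lt_of_le_of_lt ht₁₂ ht₂⟩
  have hcont : Continuous (u t₁) := (hcl.contDiff_velocity ht₁T).continuous
  -- a `k`-fold cover makes the class at `t₁` nonempty at level `g`
  obtain ⟨γ₁, hγ₁, hg₁⟩ := exists_level_of_circulation_ne_zero hcont hγ₀ hc₀ hg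
  -- Stub 2: the finite relaxed law at every lower level `g' < g`.
  have h2 : ∀ g' : ℝ, 0 < g' → g' < g →
      ℓ⟦u t₁, g'⟧ * ENNReal.ofReal (Real.exp (-M)) ≤ ℓ⟦u t₂, g⟧ :=
    stub_finiteRelaxedLaw ν T hν hT u p hcl hLH hdec g hg t₁ t₂ ht₁ ht₁₂ ht₂ Φ M hΦ hM hmaj hint
      ⟨γ₁, hγ₁, hg₁⟩ ⟨γ₂, hγ₂, hg₂⟩
  -- Stub 3: level left-continuity at `t₁`.
  have h3 : ℓ⟦u t₁, g⟧ ≤ ⨆ (g' : ℝ) (_ : 0 < g' ∧ g' < g), ℓ⟦u t₁, g'⟧ :=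
    stub_levelLeftContinuity ν T hν hT u p hcl hLH hdec t₁ ht₁T g hg ⟨γ₁, hγ₁, hg₁⟩
  -- chain in `ℝ≥0∞`
  calc ℓ⟦u t₁, g⟧ * ENNReal.ofReal (Real.exp (-M))
      ≤ (⨆ (g' : ℝ) (_ : 0 < g' ∧ g' < g), ℓ⟦u t₁, g'⟧) * ENNReal.ofReal (Real.exp (-M)) :=
        mul_le_mul_left h3 _
    _ = ⨆ (g' : ℝ), (⨆ (_ : 0 < g' ∧ g' < g), ℓ⟦u t₁, g'⟧) * ENNReal.ofReal (Real.exp (-M)) :=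
        ENNReal.iSup_mul _ _
    _ = ⨆ (g' : ℝ) (_ : 0 < g' ∧ g' < g), ℓ⟦u t₁, g'⟧ * ENNReal.ofReal (Real.exp (-M)) := by
        refine iSup_congr fun g' => ?_
        exact ENNReal.iSup_mul _ _
    _ ≤ ℓ⟦u t₂, g⟧ := iSup₂_le fun g' hg' => h2 g' hg'.1 hg'.2

end Summit.NavierStokesRegularity.NavierStokesRegularity.Cruxes.TautLoopLaw.Birth

end
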